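import Mathlib
import HarnessLib
import Summits.Ventures.LatticeQCDFlow.Exactness.SU2FTHMCGaugeCovariance

/-!
# The `SU(2)` FT-HMC kernel commutes with LATTICE TRANSLATIONS (translation-equivariant member, invariant booked density and action, translation-covariant force routine)

HONEST FRAMING: exact (Metropolis-corrected) sampling algorithms for lattice gauge theory;
figures of merit are autocorrelation/cost numbers at stated couplings and volumes; no
continuum-physics claim.

Venture `LatticeQCDFlow` (cell pub-lqcd), topic `Exactness`; FANOUT row 14 (`eng-flowhmc`, engine
`latflow.fthmc` on the periodic torus `Site d L = (Fin d → ZMod L)`).  NEW WORK of the cell; nothing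
is cited as a fact; no number.  The second symmetry of the data: a translation `a : Site d L` acts on
configurations by `(V·a)(x, μ) = V(x + a, μ)` and on momenta by the same re-indexing
`(p·a)((x, μ), i) = p((x + a, μ), i)` — a coordinate permutation, hence additive, odd,
Lebesgue-preserving (`volume_measurePreserving_piCongrLeft`) and kinetic-energy preserving; the
link drift commutes with it definitionally.  `FTHMCKernelCovariance.gauge_fthmc_conjKernel_eq_self`
then gives:

* **`su2_fthmc_conjKernel_translate`** — for every translation `a`, every member `F` with
  `F(V·a) = (F V)·a`, booked density and action with `J(V·a) = J V`, `S(V·a) = S V` (measurable),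
  any `c`, `n`, and any measurable force routine with `g(V·a) = (g V)·a`, the engine's `SU(2)`
  FT-HMC configuration kernel commutes with the translation (as the measurable equivalence
  `V ↦ V·a`, inverse `V ↦ V·(−a)`): `conjKernel K Θ_a = K`;
* what it means: **`su2_fthmc_apply_translate`** (`K(V·a, A) = K(V, {U | U·a ∈ A})`),
  **`su2_fthmc_lawIterate_translate`** (the run from translated initial data is the translate of
  the run, at every time).

NOT CLAIMED: translation-equivariance of the engine's members (the parity-masked LO member is
equivariant under EVEN translations only — not typed here); covariance of the exact force under
translations (the argument of `SU2ExactForceCovariance` applies verbatim — not typed here);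
rotations/reflections of the lattice; any number.
-/

noncomputable section

namespace Summit.Ventures.LatticeQCDFlow.Exactness

open WithLp Set MeasureTheory
open ProbabilityTheory ProbabilityTheory.Kernel
open Literature.MathematicalPhysics.QuantumFieldTheory
open scoped ENNReal Matrix

variable {d L : ℕ} [NeZero L]

/-- **The engine's `SU(2)` FT-HMC configuration kernel commutes with every lattice translation**
(translation-equivariant member, translation-invariant measurable `J` and `S`, translation-covariant
measurable force routine; any `c`, `n`). -/
theorem su2_fthmc_conjKernel_translate (a : Site d L)
    (F : GaugeConfig d L (Matrix.specialUnitaryGroup (Fin 2) ℂ) ≃ᵐ GaugeConfig d L (Matrix.specialUnitaryGroup (Fin 2) ℂ)) (hF : ∀ V : GaugeConfig d L (Matrix.specialUnitaryGroup (Fin 2) ℂ), F (fun e : Edge d L => V (e.1 + a, e.2)) = (fun e : Edge d L => (F V) (e.1 + a, e.2)))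
    {J : GaugeConfig d L (Matrix.specialUnitaryGroup (Fin 2) ℂ) → ℝ} (hJm : Measurable J) (hJ : ∀ V : GaugeConfig d L (Matrix.specialUnitaryGroup (Fin 2) ℂ), J (fun e : Edge d L => V (e.1 + a, e.2)) = J V)
    {S : GaugeConfig d L (Matrix.specialUnitaryGroup (Fin 2) ℂ) → ℝ} (hS : Measurable S) (hSi : ∀ V : GaugeConfig d L (Matrix.specialUnitaryGroup (Fin 2) ℂ), S (fun e : Edge d L => V (e.1 + a, e.2)) = S V) (c : ℝ)
    {g : GaugeConfig d L (Matrix.specialUnitaryGroup (Fin 2) ℂ) → ((Edge d L × Fin 3) → ℝ)} (hg : Measurable g)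
    (hgc : ∀ V : GaugeConfig d L (Matrix.specialUnitaryGroup (Fin 2) ℂ), g (fun e : Edge d L => V (e.1 + a, e.2)) = (fun q : Edge d L × Fin 3 => (g V) ((q.1.1 + a, q.1.2), q.2))) (n : ℕ) :
    conjKernel
      (conjKernel
        (refreshUpdate
          (involMH
            (⇑((flip : Equiv.Perm (GaugeConfig d L (Matrix.specialUnitaryGroup (Fin 2) ℂ) × ((Edge d L × Fin 3) → ℝ))) *
                leapfrog (mulDrift fun p : ((Edge d L × Fin 3) → ℝ) =>
                  fun ℓ : Edge d L => gaussUnit (toLp 2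
          ![Real.cos (c * Real.sqrt (p (ℓ, 0) ^ 2 + p (ℓ, 1) ^ 2 + p (ℓ, 2) ^ 2)),
            c * Real.sinc (c * Real.sqrt (p (ℓ, 0) ^ 2 + p (ℓ, 1) ^ 2 + p (ℓ, 2) ^ 2)) * p (ℓ, 0),
            c * Real.sinc (c * Real.sqrt (p (ℓ, 0) ^ 2 + p (ℓ, 1) ^ 2 + p (ℓ, 2) ^ 2)) * p (ℓ, 1),
            c * Real.sinc (c * Real.sqrt (p (ℓ, 0) ^ 2 + p (ℓ, 1) ^ 2 + p (ℓ, 2) ^ 2)) * p (ℓ, 2)])) g ^ n))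
            (measurable_flip_leapfrog_pow (measurable_mulDrift (measurable_su2Drift c)) hg n)
            fun z : GaugeConfig d L (Matrix.specialUnitaryGroup (Fin 2) ℂ) × ((Edge d L × Fin 3) → ℝ) =>
              (S (F z.1) - Real.log (J z.1)) + ∑ i, z.2 i ^ 2 / 2)
          ((((volume : Measure ((Edge d L × Fin 3) → ℝ)).withDensity
                  fun p => ENNReal.ofReal (Real.exp (-(∑ i, p i ^ 2 / 2)))) Set.univ)⁻¹ •
              (volume : Measure ((Edge d L × Fin 3) → ℝ)).withDensity
                fun p => ENNReal.ofReal (Real.exp (-(∑ i, p i ^ 2 / 2)))))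
        F)
      ({ toFun := fun V : GaugeConfig d L (Matrix.specialUnitaryGroup (Fin 2) ℂ) => (fun e : Edge d L => V (e.1 + a, e.2)),
         invFun := fun V : GaugeConfig d L (Matrix.specialUnitaryGroup (Fin 2) ℂ) => (fun e : Edge d L => V (e.1 - a, e.2)),
         left_inv := fun V => funext fun e => by simp only [sub_add_cancel],
         right_inv := fun V => funext fun e => by simp only [add_sub_cancel_right],
         measurable_toFun := measurable_pi_lambda _ fun e => measurable_pi_apply _,
         measurable_invFun := measurable_pi_lambda _ fun e => measurable_pi_apply _ } : GaugeConfig d L (Matrix.specialUnitaryGroup (Fin 2) ℂ) ≃ᵐ GaugeConfig d L (Matrix.specialUnitaryGroup (Fin 2) ℂ)) =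
      (conjKernel
        (refreshUpdate
          (involMH
            (⇑((flip : Equiv.Perm (GaugeConfig d L (Matrix.specialUnitaryGroup (Fin 2) ℂ) × ((Edge d L × Fin 3) → ℝ))) *
                leapfrog (mulDrift fun p : ((Edge d L × Fin 3) → ℝ) =>
                  fun ℓ : Edge d L => gaussUnit (toLp 2
          ![Real.cos (c * Real.sqrt (p (ℓ, 0) ^ 2 + p (ℓ, 1) ^ 2 + p (ℓ, 2) ^ 2)),
            c * Real.sinc (c * Real.sqrt (p (ℓ, 0) ^ 2 + p (ℓ, 1) ^ 2 + p (ℓ, 2) ^ 2)) * p (ℓ, 0),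
            c * Real.sinc (c * Real.sqrt (p (ℓ, 0) ^ 2 + p (ℓ, 1) ^ 2 + p (ℓ, 2) ^ 2)) * p (ℓ, 1),
            c * Real.sinc (c * Real.sqrt (p (ℓ, 0) ^ 2 + p (ℓ, 1) ^ 2 + p (ℓ, 2) ^ 2)) * p (ℓ, 2)])) g ^ n))
            (measurable_flip_leapfrog_pow (measurable_mulDrift (measurable_su2Drift c)) hg n)
            fun z : GaugeConfig d L (Matrix.specialUnitaryGroup (Fin 2) ℂ) × ((Edge d L × Fin 3) → ℝ) =>
              (S (F z.1) - Real.log (J z.1)) + ∑ i, z.2 i ^ 2 / 2)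
          ((((volume : Measure ((Edge d L × Fin 3) → ℝ)).withDensity
                  fun p => ENNReal.ofReal (Real.exp (-(∑ i, p i ^ 2 / 2)))) Set.univ)⁻¹ •
              (volume : Measure ((Edge d L × Fin 3) → ℝ)).withDensity
                fun p => ENNReal.ofReal (Real.exp (-(∑ i, p i ^ 2 / 2)))))
        F) := by
  -- the momentum translation as the coordinate-permutation equivalence
  let σ : (Edge d L × Fin 3) ≃ (Edge d L × Fin 3) := (Equiv.prodCongr (Equiv.prodCongr (Equiv.addRight a) (Equiv.refl (Fin d))) (Equiv.refl (Fin 3)))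
  let R : ((Edge d L × Fin 3) → ℝ) ≃ᵐ ((Edge d L × Fin 3) → ℝ) := MeasurableEquiv.piCongrLeft (fun _ : Edge d L × Fin 3 => ℝ) σ.symm
  have hRapply : ∀ p : ((Edge d L × Fin 3) → ℝ), R p = (fun q : Edge d L × Fin 3 => p ((q.1.1 + a, q.1.2), q.2)) := by
    intro p
    funext q
    change (Equiv.piCongrLeft (fun _ : Edge d L × Fin 3 => ℝ) σ.symm) p q = _
    rw [Equiv.piCongrLeft_apply_eq_cast, cast_eq]
    rfl
  have hRneg : ∀ p, R (-p) = -R p := fun p => by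
    rw [hRapply, hRapply]
    rfl
  have hRadd : ∀ p p', R (p + p') = R p + R p' := fun p p' => by
    rw [hRapply, hRapply, hRapply]
    rfl
  have he : ∀ (p : ((Edge d L × Fin 3) → ℝ)) (V : GaugeConfig d L (Matrix.specialUnitaryGroup (Fin 2) ℂ)),
      (fun p : ((Edge d L × Fin 3) → ℝ) =>
            fun ℓ : Edge d L => gaussUnit (toLp 2
          ![Real.cos (c * Real.sqrt (p (ℓ, 0) ^ 2 + p (ℓ, 1) ^ 2 + p (ℓ, 2) ^ 2)),
            c * Real.sinc (c * Real.sqrt (p (ℓ, 0) ^ 2 + p (ℓ, 1) ^ 2 + p (ℓ, 2) ^ 2)) * p (ℓ, 0),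
            c * Real.sinc (c * Real.sqrt (p (ℓ, 0) ^ 2 + p (ℓ, 1) ^ 2 + p (ℓ, 2) ^ 2)) * p (ℓ, 1),
            c * Real.sinc (c * Real.sqrt (p (ℓ, 0) ^ 2 + p (ℓ, 1) ^ 2 + p (ℓ, 2) ^ 2)) * p (ℓ, 2)])) (R p) *
      ({ toFun := fun V : GaugeConfig d L (Matrix.specialUnitaryGroup (Fin 2) ℂ) => (fun e : Edge d L => V (e.1 + a, e.2)),
         invFun := fun V : GaugeConfig d L (Matrix.specialUnitaryGroup (Fin 2) ℂ) => (fun e : Edge d L => V (e.1 - a, e.2)),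
         left_inv := fun V => funext fun e => by simp only [sub_add_cancel],
         right_inv := fun V => funext fun e => by simp only [add_sub_cancel_right],
         measurable_toFun := measurable_pi_lambda _ fun e => measurable_pi_apply _,
         measurable_invFun := measurable_pi_lambda _ fun e => measurable_pi_apply _ } : GaugeConfig d L (Matrix.specialUnitaryGroup (Fin 2) ℂ) ≃ᵐ GaugeConfig d L (Matrix.specialUnitaryGroup (Fin 2) ℂ)) V =
      ({ toFun := fun V : GaugeConfig d L (Matrix.specialUnitaryGroup (Fin 2) ℂ) => (fun e : Edge d L => V (e.1 + a, e.2)),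
         invFun := fun V : GaugeConfig d L (Matrix.specialUnitaryGroup (Fin 2) ℂ) => (fun e : Edge d L => V (e.1 - a, e.2)),
         left_inv := fun V => funext fun e => by simp only [sub_add_cancel],
         right_inv := fun V => funext fun e => by simp only [add_sub_cancel_right],
         measurable_toFun := measurable_pi_lambda _ fun e => measurable_pi_apply _,
         measurable_invFun := measurable_pi_lambda _ fun e => measurable_pi_apply _ } : GaugeConfig d L (Matrix.specialUnitaryGroup (Fin 2) ℂ) ≃ᵐ GaugeConfig d L (Matrix.specialUnitaryGroup (Fin 2) ℂ)) ((fun p : ((Edge d L × Fin 3) → ℝ) =>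
            fun ℓ : Edge d L => gaussUnit (toLp 2
          ![Real.cos (c * Real.sqrt (p (ℓ, 0) ^ 2 + p (ℓ, 1) ^ 2 + p (ℓ, 2) ^ 2)),
            c * Real.sinc (c * Real.sqrt (p (ℓ, 0) ^ 2 + p (ℓ, 1) ^ 2 + p (ℓ, 2) ^ 2)) * p (ℓ, 0),
            c * Real.sinc (c * Real.sqrt (p (ℓ, 0) ^ 2 + p (ℓ, 1) ^ 2 + p (ℓ, 2) ^ 2)) * p (ℓ, 1),
            c * Real.sinc (c * Real.sqrt (p (ℓ, 0) ^ 2 + p (ℓ, 1) ^ 2 + p (ℓ, 2) ^ 2)) * p (ℓ, 2)])) p * V) := fun p V => by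
    rw [hRapply]
    rfl
  have hgΘ : ∀ V : GaugeConfig d L (Matrix.specialUnitaryGroup (Fin 2) ℂ), g (
      ({ toFun := fun V : GaugeConfig d L (Matrix.specialUnitaryGroup (Fin 2) ℂ) => (fun e : Edge d L => V (e.1 + a, e.2)),
         invFun := fun V : GaugeConfig d L (Matrix.specialUnitaryGroup (Fin 2) ℂ) => (fun e : Edge d L => V (e.1 - a, e.2)),
         left_inv := fun V => funext fun e => by simp only [sub_add_cancel],
         right_inv := fun V => funext fun e => by simp only [add_sub_cancel_right],
         measurable_toFun := measurable_pi_lambda _ fun e => measurable_pi_apply _,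
         measurable_invFun := measurable_pi_lambda _ fun e => measurable_pi_apply _ } : GaugeConfig d L (Matrix.specialUnitaryGroup (Fin 2) ℂ) ≃ᵐ GaugeConfig d L (Matrix.specialUnitaryGroup (Fin 2) ℂ)) V) = R (g V) := fun V => by
    rw [hRapply]
    exact hgc V
  have hTR : ∀ p : ((Edge d L × Fin 3) → ℝ), (fun p : ((Edge d L × Fin 3) → ℝ) => ∑ i, p i ^ 2 / 2) (R p) = (fun p : ((Edge d L × Fin 3) → ℝ) => ∑ i, p i ^ 2 / 2) p := by
    intro p
    change ∑ i, (R p) i ^ 2 / 2 = ∑ i, p i ^ 2 / 2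
    rw [hRapply]
    exact Fintype.sum_equiv σ _ _ (fun q => rfl)
  have hRν : MeasurePreserving R (volume : Measure ((Edge d L × Fin 3) → ℝ)) volume :=
    volume_measurePreserving_piCongrLeft (fun _ : Edge d L × Fin 3 => ℝ) σ.symm
  exact gauge_fthmc_conjKernel_eq_self (Q := GaugeConfig d L (Matrix.specialUnitaryGroup (Fin 2) ℂ)) (P := ((Edge d L × Fin 3) → ℝ)) (ν := (volume : Measure ((Edge d L × Fin 3) → ℝ)))
    (e := fun p : ((Edge d L × Fin 3) → ℝ) =>
            fun ℓ : Edge d L => gaussUnit (toLp 2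
          ![Real.cos (c * Real.sqrt (p (ℓ, 0) ^ 2 + p (ℓ, 1) ^ 2 + p (ℓ, 2) ^ 2)),
            c * Real.sinc (c * Real.sqrt (p (ℓ, 0) ^ 2 + p (ℓ, 1) ^ 2 + p (ℓ, 2) ^ 2)) * p (ℓ, 0),
            c * Real.sinc (c * Real.sqrt (p (ℓ, 0) ^ 2 + p (ℓ, 1) ^ 2 + p (ℓ, 2) ^ 2)) * p (ℓ, 1),
            c * Real.sinc (c * Real.sqrt (p (ℓ, 0) ^ 2 + p (ℓ, 1) ^ 2 + p (ℓ, 2) ^ 2)) * p (ℓ, 2)]))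
    (g := g) (S := S) (T := fun p : ((Edge d L × Fin 3) → ℝ) => ∑ i, p i ^ 2 / 2) (J := J)
    (measurable_su2Drift c) hg n hS measurable_piGaussianKinetic F hJm
    ({ toFun := fun V : GaugeConfig d L (Matrix.specialUnitaryGroup (Fin 2) ℂ) => (fun e : Edge d L => V (e.1 + a, e.2)),
         invFun := fun V : GaugeConfig d L (Matrix.specialUnitaryGroup (Fin 2) ℂ) => (fun e : Edge d L => V (e.1 - a, e.2)),
         left_inv := fun V => funext fun e => by simp only [sub_add_cancel],
         right_inv := fun V => funext fun e => by simp only [add_sub_cancel_right],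
         measurable_toFun := measurable_pi_lambda _ fun e => measurable_pi_apply _,
         measurable_invFun := measurable_pi_lambda _ fun e => measurable_pi_apply _ } : GaugeConfig d L (Matrix.specialUnitaryGroup (Fin 2) ℂ) ≃ᵐ GaugeConfig d L (Matrix.specialUnitaryGroup (Fin 2) ℂ)) R
    hRneg hRadd he hgΘ (fun V => hF V) (fun V => hSi V) (fun V => hJ V) hTR hRν

/-- **Transition probabilities are translation covariant**: `K (V·a, A) = K (V, {U | U·a ∈ A})`. -/
theorem su2_fthmc_apply_translate (a : Site d L)
    (F : GaugeConfig d L (Matrix.specialUnitaryGroup (Fin 2) ℂ) ≃ᵐ GaugeConfig d L (Matrix.specialUnitaryGroup (Fin 2) ℂ)) (hF : ∀ V : GaugeConfig d L (Matrix.specialUnitaryGroup (Fin 2) ℂ), F (fun e : Edge d L => V (e.1 + a, e.2)) = (fun e : Edge d L => (F V) (e.1 + a, e.2)))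
    {J : GaugeConfig d L (Matrix.specialUnitaryGroup (Fin 2) ℂ) → ℝ} (hJm : Measurable J) (hJ : ∀ V : GaugeConfig d L (Matrix.specialUnitaryGroup (Fin 2) ℂ), J (fun e : Edge d L => V (e.1 + a, e.2)) = J V)
    {S : GaugeConfig d L (Matrix.specialUnitaryGroup (Fin 2) ℂ) → ℝ} (hS : Measurable S) (hSi : ∀ V : GaugeConfig d L (Matrix.specialUnitaryGroup (Fin 2) ℂ), S (fun e : Edge d L => V (e.1 + a, e.2)) = S V) (c : ℝ)
    {g : GaugeConfig d L (Matrix.specialUnitaryGroup (Fin 2) ℂ) → ((Edge d L × Fin 3) → ℝ)} (hg : Measurable g)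
    (hgc : ∀ V : GaugeConfig d L (Matrix.specialUnitaryGroup (Fin 2) ℂ), g (fun e : Edge d L => V (e.1 + a, e.2)) = (fun q : Edge d L × Fin 3 => (g V) ((q.1.1 + a, q.1.2), q.2))) (n : ℕ)
    (u : GaugeConfig d L (Matrix.specialUnitaryGroup (Fin 2) ℂ)) {A : Set (GaugeConfig d L (Matrix.specialUnitaryGroup (Fin 2) ℂ))} (hA : MeasurableSet A) :
    (conjKernel
      (refreshUpdate
        (involMH
          (⇑((flip : Equiv.Perm (GaugeConfig d L (Matrix.specialUnitaryGroup (Fin 2) ℂ) × ((Edge d L × Fin 3) → ℝ))) *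
              leapfrog (mulDrift fun p : ((Edge d L × Fin 3) → ℝ) =>
                fun ℓ : Edge d L => gaussUnit (toLp 2
          ![Real.cos (c * Real.sqrt (p (ℓ, 0) ^ 2 + p (ℓ, 1) ^ 2 + p (ℓ, 2) ^ 2)),
            c * Real.sinc (c * Real.sqrt (p (ℓ, 0) ^ 2 + p (ℓ, 1) ^ 2 + p (ℓ, 2) ^ 2)) * p (ℓ, 0),
            c * Real.sinc (c * Real.sqrt (p (ℓ, 0) ^ 2 + p (ℓ, 1) ^ 2 + p (ℓ, 2) ^ 2)) * p (ℓ, 1),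
            c * Real.sinc (c * Real.sqrt (p (ℓ, 0) ^ 2 + p (ℓ, 1) ^ 2 + p (ℓ, 2) ^ 2)) * p (ℓ, 2)])) g ^ n))
          (measurable_flip_leapfrog_pow (measurable_mulDrift (measurable_su2Drift c)) hg n)
          fun z : GaugeConfig d L (Matrix.specialUnitaryGroup (Fin 2) ℂ) × ((Edge d L × Fin 3) → ℝ) =>
            (S (F z.1) - Real.log (J z.1)) + ∑ i, z.2 i ^ 2 / 2)
        ((((volume : Measure ((Edge d L × Fin 3) → ℝ)).withDensity
                  fun p => ENNReal.ofReal (Real.exp (-(∑ i, p i ^ 2 / 2)))) Set.univ)⁻¹ •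
              (volume : Measure ((Edge d L × Fin 3) → ℝ)).withDensity
                fun p => ENNReal.ofReal (Real.exp (-(∑ i, p i ^ 2 / 2)))))
      F)
      (fun e : Edge d L => u (e.1 + a, e.2)) A =
    (conjKernel
      (refreshUpdate
        (involMH
          (⇑((flip : Equiv.Perm (GaugeConfig d L (Matrix.specialUnitaryGroup (Fin 2) ℂ) × ((Edge d L × Fin 3) → ℝ))) *
              leapfrog (mulDrift fun p : ((Edge d L × Fin 3) → ℝ) =>
                fun ℓ : Edge d L => gaussUnit (toLp 2
          ![Real.cos (c * Real.sqrt (p (ℓ, 0) ^ 2 + p (ℓ, 1) ^ 2 + p (ℓ, 2) ^ 2)),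
            c * Real.sinc (c * Real.sqrt (p (ℓ, 0) ^ 2 + p (ℓ, 1) ^ 2 + p (ℓ, 2) ^ 2)) * p (ℓ, 0),
            c * Real.sinc (c * Real.sqrt (p (ℓ, 0) ^ 2 + p (ℓ, 1) ^ 2 + p (ℓ, 2) ^ 2)) * p (ℓ, 1),
            c * Real.sinc (c * Real.sqrt (p (ℓ, 0) ^ 2 + p (ℓ, 1) ^ 2 + p (ℓ, 2) ^ 2)) * p (ℓ, 2)])) g ^ n))
          (measurable_flip_leapfrog_pow (measurable_mulDrift (measurable_su2Drift c)) hg n)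
          fun z : GaugeConfig d L (Matrix.specialUnitaryGroup (Fin 2) ℂ) × ((Edge d L × Fin 3) → ℝ) =>
            (S (F z.1) - Real.log (J z.1)) + ∑ i, z.2 i ^ 2 / 2)
        ((((volume : Measure ((Edge d L × Fin 3) → ℝ)).withDensity
                  fun p => ENNReal.ofReal (Real.exp (-(∑ i, p i ^ 2 / 2)))) Set.univ)⁻¹ •
              (volume : Measure ((Edge d L × Fin 3) → ℝ)).withDensity
                fun p => ENNReal.ofReal (Real.exp (-(∑ i, p i ^ 2 / 2)))))
      F)
      u ((fun V : GaugeConfig d L (Matrix.specialUnitaryGroup (Fin 2) ℂ) => (fun e : Edge d L => V (e.1 + a, e.2))) ⁻¹' A) :=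
  apply_eq_of_conjKernel_eq_self (su2_fthmc_conjKernel_translate a F hF hJm hJ hS hSi c hg hgc n) u hA

/-- **The whole run is translation covariant**: the law after `t` steps from translated initial data
is the translate of the law after `t` steps. -/
theorem su2_fthmc_lawIterate_translate (a : Site d L)
    (F : GaugeConfig d L (Matrix.specialUnitaryGroup (Fin 2) ℂ) ≃ᵐ GaugeConfig d L (Matrix.specialUnitaryGroup (Fin 2) ℂ)) (hF : ∀ V : GaugeConfig d L (Matrix.specialUnitaryGroup (Fin 2) ℂ), F (fun e : Edge d L => V (e.1 + a, e.2)) = (fun e : Edge d L => (F V) (e.1 + a, e.2)))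
    {J : GaugeConfig d L (Matrix.specialUnitaryGroup (Fin 2) ℂ) → ℝ} (hJm : Measurable J) (hJ : ∀ V : GaugeConfig d L (Matrix.specialUnitaryGroup (Fin 2) ℂ), J (fun e : Edge d L => V (e.1 + a, e.2)) = J V)
    {S : GaugeConfig d L (Matrix.specialUnitaryGroup (Fin 2) ℂ) → ℝ} (hS : Measurable S) (hSi : ∀ V : GaugeConfig d L (Matrix.specialUnitaryGroup (Fin 2) ℂ), S (fun e : Edge d L => V (e.1 + a, e.2)) = S V) (c : ℝ)
    {g : GaugeConfig d L (Matrix.specialUnitaryGroup (Fin 2) ℂ) → ((Edge d L × Fin 3) → ℝ)} (hg : Measurable g)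
    (hgc : ∀ V : GaugeConfig d L (Matrix.specialUnitaryGroup (Fin 2) ℂ), g (fun e : Edge d L => V (e.1 + a, e.2)) = (fun q : Edge d L × Fin 3 => (g V) ((q.1.1 + a, q.1.2), q.2))) (n : ℕ)
    (μ₀ : Measure (GaugeConfig d L (Matrix.specialUnitaryGroup (Fin 2) ℂ))) (t : ℕ) :
    (fun m : Measure (GaugeConfig d L (Matrix.specialUnitaryGroup (Fin 2) ℂ)) => m.bind
      (conjKernel
        (refreshUpdate
          (involMH
            (⇑((flip : Equiv.Perm (GaugeConfig d L (Matrix.specialUnitaryGroup (Fin 2) ℂ) × ((Edge d L × Fin 3) → ℝ))) *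
                leapfrog (mulDrift fun p : ((Edge d L × Fin 3) → ℝ) =>
                  fun ℓ : Edge d L => gaussUnit (toLp 2
          ![Real.cos (c * Real.sqrt (p (ℓ, 0) ^ 2 + p (ℓ, 1) ^ 2 + p (ℓ, 2) ^ 2)),
            c * Real.sinc (c * Real.sqrt (p (ℓ, 0) ^ 2 + p (ℓ, 1) ^ 2 + p (ℓ, 2) ^ 2)) * p (ℓ, 0),
            c * Real.sinc (c * Real.sqrt (p (ℓ, 0) ^ 2 + p (ℓ, 1) ^ 2 + p (ℓ, 2) ^ 2)) * p (ℓ, 1),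
            c * Real.sinc (c * Real.sqrt (p (ℓ, 0) ^ 2 + p (ℓ, 1) ^ 2 + p (ℓ, 2) ^ 2)) * p (ℓ, 2)])) g ^ n))
            (measurable_flip_leapfrog_pow (measurable_mulDrift (measurable_su2Drift c)) hg n)
            fun z : GaugeConfig d L (Matrix.specialUnitaryGroup (Fin 2) ℂ) × ((Edge d L × Fin 3) → ℝ) =>
              (S (F z.1) - Real.log (J z.1)) + ∑ i, z.2 i ^ 2 / 2)
          ((((volume : Measure ((Edge d L × Fin 3) → ℝ)).withDensity
                  fun p => ENNReal.ofReal (Real.exp (-(∑ i, p i ^ 2 / 2)))) Set.univ)⁻¹ •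
              (volume : Measure ((Edge d L × Fin 3) → ℝ)).withDensity
                fun p => ENNReal.ofReal (Real.exp (-(∑ i, p i ^ 2 / 2)))))
        F))^[t]
      (μ₀.map (fun V : GaugeConfig d L (Matrix.specialUnitaryGroup (Fin 2) ℂ) => (fun e : Edge d L => V (e.1 + a, e.2)))) =
    ((fun m : Measure (GaugeConfig d L (Matrix.specialUnitaryGroup (Fin 2) ℂ)) => m.bind
      (conjKernel
        (refreshUpdate
          (involMH
            (⇑((flip : Equiv.Perm (GaugeConfig d L (Matrix.specialUnitaryGroup (Fin 2) ℂ) × ((Edge d L × Fin 3) → ℝ))) *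
                leapfrog (mulDrift fun p : ((Edge d L × Fin 3) → ℝ) =>
                  fun ℓ : Edge d L => gaussUnit (toLp 2
          ![Real.cos (c * Real.sqrt (p (ℓ, 0) ^ 2 + p (ℓ, 1) ^ 2 + p (ℓ, 2) ^ 2)),
            c * Real.sinc (c * Real.sqrt (p (ℓ, 0) ^ 2 + p (ℓ, 1) ^ 2 + p (ℓ, 2) ^ 2)) * p (ℓ, 0),
            c * Real.sinc (c * Real.sqrt (p (ℓ, 0) ^ 2 + p (ℓ, 1) ^ 2 + p (ℓ, 2) ^ 2)) * p (ℓ, 1),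
            c * Real.sinc (c * Real.sqrt (p (ℓ, 0) ^ 2 + p (ℓ, 1) ^ 2 + p (ℓ, 2) ^ 2)) * p (ℓ, 2)])) g ^ n))
            (measurable_flip_leapfrog_pow (measurable_mulDrift (measurable_su2Drift c)) hg n)
            fun z : GaugeConfig d L (Matrix.specialUnitaryGroup (Fin 2) ℂ) × ((Edge d L × Fin 3) → ℝ) =>
              (S (F z.1) - Real.log (J z.1)) + ∑ i, z.2 i ^ 2 / 2)
          ((((volume : Measure ((Edge d L × Fin 3) → ℝ)).withDensity
                  fun p => ENNReal.ofReal (Real.exp (-(∑ i, p i ^ 2 / 2)))) Set.univ)⁻¹ •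
              (volume : Measure ((Edge d L × Fin 3) → ℝ)).withDensity
                fun p => ENNReal.ofReal (Real.exp (-(∑ i, p i ^ 2 / 2)))))
        F))^[t] μ₀).map (fun V : GaugeConfig d L (Matrix.specialUnitaryGroup (Fin 2) ℂ) => (fun e : Edge d L => V (e.1 + a, e.2))) :=
  iterate_bind_map_of_conjKernel_eq_self
    (su2_fthmc_conjKernel_translate a F hF hJm hJ hS hSi c hg hgc n) μ₀ t

end Summit.Ventures.LatticeQCDFlow.Exactness
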